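import Summits.KontsevichZagierPeriods.KontsevichZagierPeriods.Theses.FermatIsogeny
import Summits.KontsevichZagierPeriods.KontsevichZagierPeriods.Theorems.FermatIsogenyBetaLinearSectorThirds
import Summits.KontsevichZagierPeriods.KontsevichZagierPeriods.Theorems.FermatIsogenyBetaLinearSectorQuartersBridges
import Summits.KontsevichZagierPeriods.KontsevichZagierPeriods.Theorems.TorsionLogsGKZLevelThreePairBetaEulerReflection
import Summits.KontsevichZagierPeriods.KontsevichZagierPeriods.Theorems.FermatIsogenyBetaLinearSectorSixthsIsogeny
import Summits.KontsevichZagierPeriods.KontsevichZagierPeriods.Theorems.FermatIsogenyBetaLinearSectorSixthsReflection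
import Summits.KontsevichZagierPeriods.KontsevichZagierPeriods.Theorems.FermatIsogenyBetaLinearSectorSixthsStubHalfSumDuplication

/-!
# `BetaLinearSector` at level `6` — NORMAL FORMS of the rational, `π`- and `Γ(1/3)³/π`-classes (26 of the 36 base cells)

Support file of crux `BetaLinearSector` (stmt-KontsevichZagierPeriods-3897, route FermatIsogeny) towards the level-`6` rung (`a, b, a', b' ∈ ⅙ℤ`).
After level reduction the base cells are `β(a,b)`, `a, b ∈ {1/6, 1/3, 1/2, 2/3, 5/6, 1}`; their values fall into the classes `ℚ̄·1` (`a = 1` or `b = 1`),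
`ℚ̄·π` (`a + b = 1`), `ℚ̄·Γ(1/3)³/π` (`a + b < 1`) and `ℚ̄·π²/Γ(1/3)³` (`a + b > 1`, `a, b < 1`).  This file gives the NORMAL FORM of every base cell
of the first three classes (registered anchor `normalForm_sixths_lower`): a chain of moves onto `(c q)·T_i` for a positive real algebraic `q` and the
canonical cells `T₀ = [β(1,1)]`, `T₁ = [β(1/2,1/2)]`, `T₂ = [β(1/3,1/2)]`.  Inputs, all realised INSIDE the calculus and landed: the rational class
(`Thirds.nf_a_one`), Euler's reflection at `1/3` and `1/2` through the disc (`GKZLevelThree.eulerReflectionRational_one_third`, `stubEulerReflection_half`)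
and at `1/6` (`Sixths.betaSixth_equivalent_two_piRep`), Legendre's duplication (`Quarters.pinned_duplication`: `(2,2) ∼ 2^{1/3}(2,3)`,
`(1,1) ∼ 2^{2/3}(1,3)` in sixths), the CM `3`-isogeny (`Sixths.pinned_sixthHalf_equivalent_sqrt3_thirdHalf`: `(1,3) ∼ √3·(2,3)`) and the half-sum
duplication (`Sixths.stub_betaHalfSum_duplication`: `(1,2) ∼ 2^{2/3}(2,2)`, `(2,1) ∼ 2^{1/3}(4,1)`).  The ten cells of the fourth class (`a + b > 1`) are
NOT treated here (their links need second-kind / finite-arc chains; see the lead card).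
References: M. Kontsevich, D. Zagier, *Periods* (2001), §1.2; N. Koblitz, D. Rohrlich, *Simple factors in the Jacobian of a Fermat curve*, Canad. J.
Math. 30 (1978); G. E. Andrews, R. Askey, R. Roy, *Special Functions* (1999), §1.5.
-/

noncomputable section

namespace Summit.KontsevichZagierPeriods.FermatIsogeny.BetaLinearSector.Sixths

open MeasureTheory Set Literature.NumberTheory.Transcendental Literature.NumberTheory.Transcendental.KZ HalfIntegers
open Summit.KontsevichZagierPeriods.FermatIsogeny.BetaLinearSector.Thirds (nf_a_one)
open Summit.KontsevichZagierPeriods.FermatIsogeny.BetaLinearSector.Quarters (pinned_duplication)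
open Summit.KontsevichZagierPeriods.KontsevichZagierPeriods.Theorems.GKZLevelThree (eulerReflectionRational_one_third)
open Summit.KontsevichZagierPeriods.KontsevichZagierPeriods.BetaCancellationNegative (stubEulerReflection_half)

set_option quotPrecheck false in
/-- `r` is PINNED as `[(0,1), c · t^{a-1}(1-t)^{b-1}]` (the two hypotheses on each representation in the crux, with a constant). -/
local notation "Pinned⟦" c ", " a ", " b ", " r "⟧" =>
  (IntegralRep.domain r = {x : Fin 1 → ℝ | x 0 ∈ Set.Ioo (0:ℝ) 1} ∧
    Set.EqOn (IntegralRep.integrand r) (fun x : Fin 1 → ℝ => (c : ℝ) * (x 0) ^ (((a : ℚ) : ℝ) - 1) * (1 - x 0) ^ (((b : ℚ) : ℝ) - 1))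
      (IntegralRep.domain r))

/-! ## Generic plumbing -/

/-- Scaling a canonical cell keeps it pinned, with the scaled constant. [cite: KontsevichZagier2001, §1.2 rule (1)] -/
theorem pinned_constMul {a b : ℚ} {T : IntegralRep 1} (hT : Pinned⟦(1:ℝ), a, b, T⟧) (k : ℝ) (hk : IsAlgebraic ℚ k) :
    Pinned⟦k, a, b, T.constMul k hk⟧ :=
  ⟨by rw [IntegralRep.domain_constMul, hT.1], fun x hx => by
    have hx' : x ∈ T.domain := by simpa using hx
    simp only [IntegralRep.integrand_constMul, hT.2 hx', one_mul]
    ring⟩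

/-- NORMAL FORM through a unit cell: if `r` is pinned `(c,a,b)`, `U` is pinned `(1,a,b)` and `U ∼ q·T`, then `r ∼ (c q)·T`.
[cite: KontsevichZagier2001, §1.2 rule (1)] -/
theorem nf_via_unit {c q : ℝ} (hc : IsAlgebraic ℚ c) (hq : IsAlgebraic ℚ q) (hqpos : 0 < q) {a b : ℚ} {r U T : IntegralRep 1}
    (hr : Pinned⟦c, a, b, r⟧) (hU : Pinned⟦(1:ℝ), a, b, U⟧) (eU : Equivalent U (T.constMul q hq)) :
    ∃ (q' : ℝ) (hk : IsAlgebraic ℚ (c * q')), 0 < q' ∧ Equivalent r (T.constMul (c * q') hk) := by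
  refine ⟨q, hc.mul hq, hqpos, (equivalent_constMul_of_pinned hc hr hU (mul_one c).symm).trans ?_⟩
  refine (eU.constMul c hc).trans (of_sub_of_mem_relations_of_eqOn rfl fun x _ => ?_)
  simp only [IntegralRep.integrand_constMul]
  ring

/-- The same after a swap of the exponents. [cite: KontsevichZagier2001, §1.2 rules (1), (2)] -/
theorem nf_via_unit_swap {c q : ℝ} (hc : IsAlgebraic ℚ c) (hq : IsAlgebraic ℚ q) (hqpos : 0 < q) {a b : ℚ} (ha : 0 < a) (hb : 0 < b)
    {r U T : IntegralRep 1} (hr : Pinned⟦c, b, a, r⟧) (hU : Pinned⟦(1:ℝ), a, b, U⟧) (eU : Equivalent U (T.constMul q hq)) :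
    ∃ (q' : ℝ) (hk : IsAlgebraic ℚ (c * q')), 0 < q' ∧ Equivalent r (T.constMul (c * q') hk) := by
  obtain ⟨ρ, hρ⟩ := exists_pinned c hc ha hb
  have e : Equivalent r ρ := pinned_swap hc hb ha hr hρ
  obtain ⟨q', hk, hq', e'⟩ := nf_via_unit hc hq hqpos hρ hU eU
  exact ⟨q', hk, hq', e.trans e'⟩

/-- `2^{1/3}`, `2^{2/3}` are real algebraic and positive. [folklore] -/
theorem isAlgebraic_two_rpow (e : ℚ) : IsAlgebraic ℚ ((2:ℝ) ^ (e:ℝ)) := by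
  have h2 : IsAlgebraic ℚ (2:ℝ) := by simpa using isAlgebraic_nat (R := ℚ) (A := ℝ) 2
  -- `(2^e)^den = 2^num` is algebraic, so `2^e` is
  have hden : (0 : ℕ) < e.den := e.den_pos
  have hpow : ((2:ℝ) ^ (e:ℝ)) ^ e.den = (2:ℝ) ^ (e.num : ℝ) := by
    rw [← Real.rpow_natCast, ← Real.rpow_mul (by norm_num)]
    congr 1
    have := Rat.mul_den_eq_num e
    have h' : ((e : ℝ)) * (e.den : ℝ) = (e.num : ℝ) := by exact_mod_cast this
    exact h'
  have halg : IsAlgebraic ℚ (((2:ℝ) ^ (e:ℝ)) ^ e.den) := by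
    rw [hpow]
    rcases le_or_gt 0 e.num with h | h
    · obtain ⟨n, hn⟩ := Int.eq_ofNat_of_zero_le h
      rw [hn, Int.cast_natCast, Real.rpow_natCast]
      exact h2.pow n
    · obtain ⟨n, hn⟩ := Int.exists_eq_neg_ofNat h.le
      rw [hn, Int.cast_neg, Int.cast_natCast, Real.rpow_neg (by norm_num), Real.rpow_natCast]
      exact (h2.pow n).inv
  exact IsAlgebraic.of_pow hden halg

/-! ## The unit cells of the `Γ(1/3)³/π`-class, normalised onto `T₂ = [β(1/3,1/2)]` -/

section G1

variable {T₂ : IntegralRep 1} (hT₂ : Pinned⟦(1:ℝ), (1/3:ℚ), (1/2:ℚ), T₂⟧)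
include hT₂

/-- `(2,3)`: a unit cell `β(1/3,1/2)` IS `1·T₂`. -/
theorem unit_23 {U : IntegralRep 1} (hU : Pinned⟦(1:ℝ), (1/3:ℚ), (1/2:ℚ), U⟧) : Equivalent U (T₂.constMul 1 isAlgebraic_one) :=
  equivalent_constMul_of_pinned isAlgebraic_one hU hT₂ (by norm_num)

/-- `(2,2) ∼ 2^{1/3}·(2,3)`: Legendre's duplication at `a = 1/3`. [cite: AndrewsAskeyRoy1999, Thm 1.5.1] -/
theorem unit_22 {U : IntegralRep 1} (hU : Pinned⟦(1:ℝ), (1/3:ℚ), (1/3:ℚ), U⟧) :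
    Equivalent U (T₂.constMul ((2:ℝ) ^ (((1/3:ℚ)):ℝ)) (isAlgebraic_two_rpow (1/3))) := by
  refine pinned_duplication (by norm_num) ?_ hU (pinned_constMul hT₂ _ _)
  norm_num

/-- `(1,3) ∼ √3·(2,3)`: the CM `3`-isogeny. -/
theorem unit_13 (h3 : IsAlgebraic ℚ (Real.sqrt 3)) {U : IntegralRep 1} (hU : Pinned⟦(1:ℝ), (1/6:ℚ), (1/2:ℚ), U⟧) :
    Equivalent U (T₂.constMul (Real.sqrt 3) h3) := by
  have hD := pinned_constMul hT₂ (Real.sqrt 3) h3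
  exact pinned_sixthHalf_equivalent_sqrt3_thirdHalf U _ hU.1 (fun x hx => by simp only [hU.2 hx, one_mul]) hD.1 hD.2

/-- `(1,1) ∼ 2^{2/3}√3·(2,3)`: duplication at `a = 1/6`, then the isogeny. -/
theorem unit_11 (h3 : IsAlgebraic ℚ (Real.sqrt 3)) {U : IntegralRep 1} (hU : Pinned⟦(1:ℝ), (1/6:ℚ), (1/6:ℚ), U⟧)
    (hk : IsAlgebraic ℚ ((2:ℝ) ^ (((2/3:ℚ)):ℝ) * Real.sqrt 3)) : Equivalent U (T₂.constMul ((2:ℝ) ^ (((2/3:ℚ)):ℝ) * Real.sqrt 3) hk) := by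
  obtain ⟨U₂, hU₂⟩ := exists_pinned 1 isAlgebraic_one (by norm_num : (0:ℚ) < 1/6) (by norm_num : (0:ℚ) < 1/2)
  have e₁ : Equivalent U (U₂.constMul ((2:ℝ) ^ (((2/3:ℚ)):ℝ)) (isAlgebraic_two_rpow (2/3))) := by
    refine pinned_duplication (by norm_num) ?_ hU (pinned_constMul hU₂ _ _)
    norm_num
  have e₂ := (unit_13 hT₂ h3 hU₂).constMul ((2:ℝ) ^ (((2/3:ℚ)):ℝ)) (isAlgebraic_two_rpow (2/3))
  refine e₁.trans (e₂.trans (of_sub_of_mem_relations_of_eqOn rfl fun x _ => ?_))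
  simp only [IntegralRep.integrand_constMul]
  ring

/-- `(1,2) ∼ 2·(2,3)`: the half-sum duplication at `a = 1/6`, then duplication at `1/3`. -/
theorem unit_12 {U : IntegralRep 1} (hU : Pinned⟦(1:ℝ), (1/6:ℚ), (1/3:ℚ), U⟧) (hk : IsAlgebraic ℚ (2:ℝ)) :
    Equivalent U (T₂.constMul 2 hk) := by
  obtain ⟨U₃, hU₃⟩ := exists_pinned 1 isAlgebraic_one (by norm_num : (0:ℚ) < 1/3) (by norm_num : (0:ℚ) < 1/3)
  have hD := pinned_constMul hU₃ ((2:ℝ) ^ (((2/3:ℚ)):ℝ)) (isAlgebraic_two_rpow (2/3))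
  have e₁ : Equivalent U (U₃.constMul ((2:ℝ) ^ (((2/3:ℚ)):ℝ)) (isAlgebraic_two_rpow (2/3))) := by
    refine stub_betaHalfSum_duplication (1/6) (by norm_num) (by norm_num) U _ hU.1 (fun x hx => ?_) hD.1 (fun x hx => ?_)
    · rw [hU.2 hx]; norm_num
    · rw [hD.2 hx]; norm_num; ring
  have e₂ := (unit_22 hT₂ hU₃).constMul ((2:ℝ) ^ (((2/3:ℚ)):ℝ)) (isAlgebraic_two_rpow (2/3))
  refine e₁.trans (e₂.trans (of_sub_of_mem_relations_of_eqOn rfl fun x _ => ?_))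
  simp only [IntegralRep.integrand_constMul]
  have h : (2:ℝ) ^ (((2/3:ℚ)):ℝ) * (2:ℝ) ^ (((1/3:ℚ)):ℝ) = 2 := by
    rw [← Real.rpow_add (by norm_num)]; norm_num
  rw [show (2:ℝ) ^ (((2/3:ℚ)):ℝ) * ((2:ℝ) ^ (((1/3:ℚ)):ℝ) * T₂.integrand x) = 2 * T₂.integrand x by rw [← mul_assoc, h]]

/-- `(4,1) ∼ 2^{2/3}·(2,3)`: the half-sum duplication at `a = 1/3` (`(2,1) ∼ 2^{1/3}(4,1)`), a swap and `(1,2) ∼ 2·(2,3)`. -/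
theorem unit_41 {U : IntegralRep 1} (hU : Pinned⟦(1:ℝ), (2/3:ℚ), (1/6:ℚ), U⟧) :
    Equivalent U (T₂.constMul ((2:ℝ) ^ (((2/3:ℚ)):ℝ)) (isAlgebraic_two_rpow (2/3))) := by
  have h2 : IsAlgebraic ℚ (2:ℝ) := by simpa using isAlgebraic_nat (R := ℚ) (A := ℝ) 2
  obtain ⟨U₄, hU₄⟩ := exists_pinned 1 isAlgebraic_one (by norm_num : (0:ℚ) < 1/3) (by norm_num : (0:ℚ) < 1/6)
  obtain ⟨U₅, hU₅⟩ := exists_pinned 1 isAlgebraic_one (by norm_num : (0:ℚ) < 1/6) (by norm_num : (0:ℚ) < 1/3)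
  have hD := pinned_constMul hU ((2:ℝ) ^ (((1/3:ℚ)):ℝ)) (isAlgebraic_two_rpow (1/3))
  -- `U₄ = β(1/3,1/6) ∼ 2^{1/3}·U`
  have e₁ : Equivalent U₄ (U.constMul ((2:ℝ) ^ (((1/3:ℚ)):ℝ)) (isAlgebraic_two_rpow (1/3))) := by
    refine stub_betaHalfSum_duplication (1/3) (by norm_num) (by norm_num) U₄ _ hU₄.1 (fun x hx => ?_) hD.1 (fun x hx => ?_)
    · rw [hU₄.2 hx]; norm_num
    · rw [hD.2 hx]; norm_num; ring
  -- `U₄ ∼ U₅ = β(1/6,1/3) ∼ 2·T₂`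
  have e₂ : Equivalent U₄ U₅ := pinned_swap isAlgebraic_one (by norm_num) (by norm_num) hU₄ hU₅
  have e₃ := unit_12 hT₂ hU₅ h2
  -- so `2^{1/3}·U ∼ 2·T₂`, `U ∼ 2^{-1/3}·2·T₂ = 2^{2/3}·T₂`
  have e₄ := ((e₁.symm.trans (e₂.trans e₃)).constMul ((2:ℝ) ^ (((-1/3:ℚ)):ℝ)) (isAlgebraic_two_rpow (-1/3)))
  have hl : Equivalent U ((U.constMul ((2:ℝ) ^ (((1/3:ℚ)):ℝ)) (isAlgebraic_two_rpow (1/3))).constMul ((2:ℝ) ^ (((-1/3:ℚ)):ℝ))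
      (isAlgebraic_two_rpow (-1/3))) := by
    refine of_sub_of_mem_relations_of_eqOn rfl fun x _ => ?_
    simp only [IntegralRep.integrand_constMul, ← mul_assoc, ← Real.rpow_add (show (0:ℝ) < 2 by norm_num)]
    norm_num
  refine hl.trans (e₄.trans (of_sub_of_mem_relations_of_eqOn rfl fun x _ => ?_))
  simp only [IntegralRep.integrand_constMul, ← mul_assoc]
  congr 1
  rw [← Real.rpow_add_one two_ne_zero]
  norm_num

end G1

/-! ## The unit cells of the `π`-class, normalised onto `T₁ = [β(1/2,1/2)]` -/

section Pi

variable {T₁ : IntegralRep 1} (hT₁ : Pinned⟦(1:ℝ), (1/2:ℚ), (1/2:ℚ), T₁⟧)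
include hT₁

/-- `T₁ ∼ [π]`. -/
theorem T₁_equivalent_piRep : Equivalent T₁ piRep := by
  refine stubEulerReflection_half T₁ piRep hT₁.1 (fun x hx => ?_) rfl (fun _ _ => rfl)
  rw [hT₁.2 hx, show Real.pi * ((1/2 : ℚ) : ℝ) = Real.pi / 2 by push_cast; ring, Real.sin_pi_div_two]
  norm_num

/-- `(3,3)`: a unit cell `β(1/2,1/2)` IS `1·T₁`. -/
theorem unit_33 {U : IntegralRep 1} (hU : Pinned⟦(1:ℝ), (1/2:ℚ), (1/2:ℚ), U⟧) : Equivalent U (T₁.constMul 1 isAlgebraic_one) :=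
  equivalent_constMul_of_pinned isAlgebraic_one hU hT₁ (by norm_num)

/-- `(2,4) ∼ (2/√3)·(3,3)`: Euler's reflection at `1/3` and at `1/2` through the disc. -/
theorem unit_24 {U : IntegralRep 1} (hU : Pinned⟦(1:ℝ), (1/3:ℚ), (2/3:ℚ), U⟧) (hq : IsAlgebraic ℚ (2 / Real.sqrt 3))
    (hc : IsAlgebraic ℚ (Real.sqrt 3 / 2)) : Equivalent U (T₁.constMul (2 / Real.sqrt 3) hq) := by
  have hs : Real.sqrt 3 ≠ 0 := (Real.sqrt_pos.2 (by norm_num)).ne'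
  have e₁ : Equivalent (U.constMul (Real.sqrt 3 / 2) hc) piRep := by
    refine eulerReflectionRational_one_third _ piRep (by rw [IntegralRep.domain_constMul, hU.1]) (fun x hx => ?_) rfl (fun _ _ => rfl)
    have hx' : x ∈ U.domain := by simpa using hx
    simp only [IntegralRep.integrand_constMul, hU.2 hx', show Real.pi * ((1/3 : ℚ) : ℝ) = Real.pi / 3 by push_cast; ring,
      Real.sin_pi_div_three]
    norm_num
    ring
  have e₂ := ((e₁.trans (T₁_equivalent_piRep hT₁).symm).constMul (2 / Real.sqrt 3) hq)
  refine Equivalent.trans ?_ e₂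
  refine of_sub_of_mem_relations_of_eqOn rfl fun x _ => ?_
  simp only [IntegralRep.integrand_constMul]
  field_simp

/-- `(1,5) ∼ 2·(3,3)`: Euler's reflection at `1/6` through the disc. -/
theorem unit_15 {U : IntegralRep 1} (hU : Pinned⟦(1:ℝ), (1/6:ℚ), (5/6:ℚ), U⟧) (h2 : IsAlgebraic ℚ (2:ℝ)) : Equivalent U (T₁.constMul 2 h2) := by
  have e₁ : Equivalent U (piRep.constMul 2 h2) := betaSixth_equivalent_two_piRep h2 U hU.1 (fun x hx => by rw [hU.2 hx]; norm_num)
  exact e₁.trans ((T₁_equivalent_piRep hT₁).symm.constMul 2 h2)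

end Pi

/-! ## The normal form of the 26 lower base cells -/

/-- A positive sixth-integer in `(0,1]` is one of `1/6, 1/3, 1/2, 2/3, 5/6, 1`. [folklore] -/
theorem sixth_cases {a : ℚ} (ha : 0 < a) (ha1 : a ≤ 1) (hm : ∃ m : ℤ, a = m / 6) :
    a = 1 / 6 ∨ a = 1 / 3 ∨ a = 1 / 2 ∨ a = 2 / 3 ∨ a = 5 / 6 ∨ a = 1 := by
  obtain ⟨m, rfl⟩ := hm
  have h1 : (0 : ℚ) < m := by linarith
  have h2 : (m : ℚ) ≤ 6 := by linarith
  have h1' : 0 < m := by exact_mod_cast h1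
  have h2' : m ≤ 6 := by exact_mod_cast h2
  interval_cases m <;> norm_num

/-- **NORMAL FORM OF THE LOWER LEVEL-6 BASE CELLS** (registered anchor `normalForm_sixths_lower`): every cell `[c·β(a,b)]`, `a, b ∈ {1/6,…,1}` with
`a + b ≤ 1` or `a = 1` or `b = 1` — the rational, `π`- and `Γ(1/3)³/π`-classes — is a chain of moves away from `(c q)·T_i`, `q` positive real
algebraic, over the canonical cells `T₀ = [β(1,1)]`, `T₁ = [β(1/2,1/2)]`, `T₂ = [β(1/3,1/2)]`. [cite: KontsevichZagier2001, §1.2] -/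
theorem normalForm_sixths_lower : ∀ (c : ℝ), IsAlgebraic ℚ c → ∀ (a b : ℚ),
    (a = 1 / 6 ∨ a = 1 / 3 ∨ a = 1 / 2 ∨ a = 2 / 3 ∨ a = 5 / 6 ∨ a = 1) → (b = 1 / 6 ∨ b = 1 / 3 ∨ b = 1 / 2 ∨ b = 2 / 3 ∨ b = 5 / 6 ∨ b = 1) →
    (a + b ≤ 1 ∨ a = 1 ∨ b = 1) → ∀ (r : KZ.IntegralRep 1) (T : Fin 3 → KZ.IntegralRep 1),
    (r.domain = {x | x 0 ∈ Set.Ioo (0:ℝ) 1} ∧ Set.EqOn r.integrand (fun x => c * (x 0) ^ ((a:ℝ) - 1) * (1 - x 0) ^ ((b:ℝ) - 1)) r.domain) →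
    ((T 0).domain = {x | x 0 ∈ Set.Ioo (0:ℝ) 1} ∧ Set.EqOn (T 0).integrand (fun x => (1:ℝ) * (x 0) ^ (((1:ℚ):ℝ) - 1) * (1 - x 0) ^ (((1:ℚ):ℝ) - 1))
      (T 0).domain) →
    ((T 1).domain = {x | x 0 ∈ Set.Ioo (0:ℝ) 1} ∧ Set.EqOn (T 1).integrand (fun x => (1:ℝ) * (x 0) ^ (((1/2:ℚ):ℝ) - 1) *
      (1 - x 0) ^ (((1/2:ℚ):ℝ) - 1)) (T 1).domain) →
    ((T 2).domain = {x | x 0 ∈ Set.Ioo (0:ℝ) 1} ∧ Set.EqOn (T 2).integrand (fun x => (1:ℝ) * (x 0) ^ (((1/3:ℚ):ℝ) - 1) *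
      (1 - x 0) ^ (((1/2:ℚ):ℝ) - 1)) (T 2).domain) →
    ∃ (i : Fin 3) (q : ℝ) (hk : IsAlgebraic ℚ (c * q)), 0 < q ∧ KZ.Equivalent r ((T i).constMul (c * q) hk) := by
  intro c hc a b ha hb hlow r T hr hT0 hT1 hT2
  have hs : 0 < Real.sqrt 3 := Real.sqrt_pos.2 (by norm_num)
  have h3 : IsAlgebraic ℚ (Real.sqrt 3) := by
    refine ⟨Polynomial.X ^ 2 - Polynomial.C 3, Polynomial.X_pow_sub_C_ne_zero (by norm_num) 3, ?_⟩
    simp [Real.sq_sqrt (show (0:ℝ) ≤ 3 by norm_num)]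
  have h2 : IsAlgebraic ℚ (2:ℝ) := by simpa using isAlgebraic_nat (R := ℚ) (A := ℝ) 2
  have hq₁ : IsAlgebraic ℚ (2 / Real.sqrt 3) := by simpa [div_eq_mul_inv] using h2.mul h3.inv
  have hq₂ : IsAlgebraic ℚ (Real.sqrt 3 / 2) := by simpa [div_eq_mul_inv] using h3.mul h2.inv
  have hr13 : (0:ℝ) < (2:ℝ) ^ (((1/3:ℚ)):ℝ) := Real.rpow_pos_of_pos (by norm_num) _
  have hr23 : (0:ℝ) < (2:ℝ) ^ (((2/3:ℚ)):ℝ) := Real.rpow_pos_of_pos (by norm_num) _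
  have hk11 : IsAlgebraic ℚ ((2:ℝ) ^ (((2/3:ℚ)):ℝ) * Real.sqrt 3) := (isAlgebraic_two_rpow (2/3)).mul h3
  -- the rational class
  have rat_a : ∀ {a : ℚ}, 0 < a → Pinned⟦c, a, (1 : ℚ), r⟧ →
      ∃ (i : Fin 3) (q : ℝ) (hk : IsAlgebraic ℚ (c * q)), 0 < q ∧ Equivalent r ((T i).constMul (c * q) hk) := by
    intro a ha0 hr1
    obtain ⟨q, hk, hq, e, -⟩ := nf_a_one hc ha0 hr1 hT0
    exact ⟨0, q, hk, hq, e⟩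
  have rat_b : ∀ {b : ℚ}, 0 < b → Pinned⟦c, (1 : ℚ), b, r⟧ →
      ∃ (i : Fin 3) (q : ℝ) (hk : IsAlgebraic ℚ (c * q)), 0 < q ∧ Equivalent r ((T i).constMul (c * q) hk) := by
    intro b hb0 hr1
    obtain ⟨ρ, hρ⟩ := exists_pinned c hc hb0 (by norm_num : (0:ℚ) < 1)
    have e : Equivalent r ρ := pinned_swap hc (by norm_num) hb0 hr1 hρ
    obtain ⟨q, hk, hq, e', -⟩ := nf_a_one hc hb0 hρ hT0
    exact ⟨0, q, hk, hq, e.trans e'⟩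
  -- a unit cell for every pair of exponents
  have unit : ∀ {a b : ℚ}, 0 < a → 0 < b → ∃ U : IntegralRep 1, Pinned⟦(1:ℝ), a, b, U⟧ := fun ha hb => exists_pinned 1 isAlgebraic_one ha hb
  rcases hb with rfl | rfl | rfl | rfl | rfl | rfl
  · -- b = 1/6
    rcases ha with rfl | rfl | rfl | rfl | rfl | rfl
    · obtain ⟨U, hU⟩ := unit (by norm_num : (0:ℚ) < 1/6) (by norm_num : (0:ℚ) < 1/6)
      exact let ⟨q, hk, hq, e⟩ := nf_via_unit hc hk11 (by positivity) hr hU (unit_11 hT2 h3 hU hk11); ⟨2, q, hk, hq, e⟩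
    · obtain ⟨U, hU⟩ := unit (by norm_num : (0:ℚ) < 1/6) (by norm_num : (0:ℚ) < 1/3)
      exact let ⟨q, hk, hq, e⟩ := nf_via_unit_swap hc h2 two_pos (by norm_num) (by norm_num) hr hU (unit_12 hT2 hU h2); ⟨2, q, hk, hq, e⟩
    · obtain ⟨U, hU⟩ := unit (by norm_num : (0:ℚ) < 1/6) (by norm_num : (0:ℚ) < 1/2)
      exact let ⟨q, hk, hq, e⟩ := nf_via_unit_swap hc h3 hs (by norm_num) (by norm_num) hr hU (unit_13 hT2 h3 hU); ⟨2, q, hk, hq, e⟩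
    · obtain ⟨U, hU⟩ := unit (by norm_num : (0:ℚ) < 2/3) (by norm_num : (0:ℚ) < 1/6)
      exact let ⟨q, hk, hq, e⟩ := nf_via_unit hc (isAlgebraic_two_rpow (2/3)) hr23 hr hU (unit_41 hT2 hU); ⟨2, q, hk, hq, e⟩
    · obtain ⟨U, hU⟩ := unit (by norm_num : (0:ℚ) < 1/6) (by norm_num : (0:ℚ) < 5/6)
      exact let ⟨q, hk, hq, e⟩ := nf_via_unit_swap hc h2 two_pos (by norm_num) (by norm_num) hr hU (unit_15 hT1 hU h2); ⟨1, q, hk, hq, e⟩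
    · exact rat_b (by norm_num) hr
  · -- b = 1/3
    rcases ha with rfl | rfl | rfl | rfl | rfl | rfl
    · obtain ⟨U, hU⟩ := unit (by norm_num : (0:ℚ) < 1/6) (by norm_num : (0:ℚ) < 1/3)
      exact let ⟨q, hk, hq, e⟩ := nf_via_unit hc h2 two_pos hr hU (unit_12 hT2 hU h2); ⟨2, q, hk, hq, e⟩
    · obtain ⟨U, hU⟩ := unit (by norm_num : (0:ℚ) < 1/3) (by norm_num : (0:ℚ) < 1/3)
      exact let ⟨q, hk, hq, e⟩ := nf_via_unit hc (isAlgebraic_two_rpow (1/3)) hr13 hr hU (unit_22 hT2 hU); ⟨2, q, hk, hq, e⟩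
    · obtain ⟨U, hU⟩ := unit (by norm_num : (0:ℚ) < 1/3) (by norm_num : (0:ℚ) < 1/2)
      exact let ⟨q, hk, hq, e⟩ := nf_via_unit_swap hc isAlgebraic_one one_pos (by norm_num) (by norm_num) hr hU (unit_23 hT2 hU);
        ⟨2, q, hk, hq, e⟩
    · obtain ⟨U, hU⟩ := unit (by norm_num : (0:ℚ) < 1/3) (by norm_num : (0:ℚ) < 2/3)
      exact let ⟨q, hk, hq, e⟩ := nf_via_unit_swap hc hq₁ (by positivity) (by norm_num) (by norm_num) hr hU (unit_24 hT1 hU hq₁ hq₂);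
        ⟨1, q, hk, hq, e⟩
    · exfalso; rcases hlow with h | h | h <;> norm_num at h
    · exact rat_b (by norm_num) hr
  · -- b = 1/2
    rcases ha with rfl | rfl | rfl | rfl | rfl | rfl
    · obtain ⟨U, hU⟩ := unit (by norm_num : (0:ℚ) < 1/6) (by norm_num : (0:ℚ) < 1/2)
      exact let ⟨q, hk, hq, e⟩ := nf_via_unit hc h3 hs hr hU (unit_13 hT2 h3 hU); ⟨2, q, hk, hq, e⟩
    · obtain ⟨U, hU⟩ := unit (by norm_num : (0:ℚ) < 1/3) (by norm_num : (0:ℚ) < 1/2)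
      exact let ⟨q, hk, hq, e⟩ := nf_via_unit hc isAlgebraic_one one_pos hr hU (unit_23 hT2 hU); ⟨2, q, hk, hq, e⟩
    · obtain ⟨U, hU⟩ := unit (by norm_num : (0:ℚ) < 1/2) (by norm_num : (0:ℚ) < 1/2)
      exact let ⟨q, hk, hq, e⟩ := nf_via_unit hc isAlgebraic_one one_pos hr hU (unit_33 hT1 hU); ⟨1, q, hk, hq, e⟩
    · exfalso; rcases hlow with h | h | h <;> norm_num at h
    · exfalso; rcases hlow with h | h | h <;> norm_num at h
    · exact rat_b (by norm_num) hr
  · -- b = 2/3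
    rcases ha with rfl | rfl | rfl | rfl | rfl | rfl
    · obtain ⟨U, hU⟩ := unit (by norm_num : (0:ℚ) < 2/3) (by norm_num : (0:ℚ) < 1/6)
      exact let ⟨q, hk, hq, e⟩ := nf_via_unit_swap hc (isAlgebraic_two_rpow (2/3)) hr23 (by norm_num) (by norm_num) hr hU (unit_41 hT2 hU);
        ⟨2, q, hk, hq, e⟩
    · obtain ⟨U, hU⟩ := unit (by norm_num : (0:ℚ) < 1/3) (by norm_num : (0:ℚ) < 2/3)
      exact let ⟨q, hk, hq, e⟩ := nf_via_unit hc hq₁ (by positivity) hr hU (unit_24 hT1 hU hq₁ hq₂); ⟨1, q, hk, hq, e⟩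
    · exfalso; rcases hlow with h | h | h <;> norm_num at h
    · exfalso; rcases hlow with h | h | h <;> norm_num at h
    · exfalso; rcases hlow with h | h | h <;> norm_num at h
    · exact rat_b (by norm_num) hr
  · -- b = 5/6
    rcases ha with rfl | rfl | rfl | rfl | rfl | rfl
    · obtain ⟨U, hU⟩ := unit (by norm_num : (0:ℚ) < 1/6) (by norm_num : (0:ℚ) < 5/6)
      exact let ⟨q, hk, hq, e⟩ := nf_via_unit hc h2 two_pos hr hU (unit_15 hT1 hU h2); ⟨1, q, hk, hq, e⟩
    · exfalso; rcases hlow with h | h | h <;> norm_num at h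
    · exfalso; rcases hlow with h | h | h <;> norm_num at h
    · exfalso; rcases hlow with h | h | h <;> norm_num at h
    · exfalso; rcases hlow with h | h | h <;> norm_num at h
    · exact rat_b (by norm_num) hr
  · -- b = 1
    rcases ha with rfl | rfl | rfl | rfl | rfl | rfl <;> exact rat_a (by norm_num) hr

end Summit.KontsevichZagierPeriods.FermatIsogeny.BetaLinearSector.Sixths

end
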